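import Literature.MathematicalPhysics.QuantumLattice.LatticeGaugeDLRFreeEnergyProofs
import Literature.MathematicalPhysics.QuantumLattice.LatticeGaugeDLRGibbsProofs
import Literature.Probability.LatticeModels.GibbsSpecificationDLRProofs
import Mathlib.Analysis.Convex.Integral
import Mathlib.Analysis.Convex.SpecificFunctions.Basic

/-!
# Jensen chord inequality for the log-normaliser of the lattice Yang–Mills kernel

Helper (E1 of the energy programme) for line `Sketch` of crux `FibreToTorus`
(stmt-QuantumFields-16244), route `ContractibleFibre`.  For the normaliser
`N(β) := ∫ exp (-β S_Λ(ζ ∨ η)) dζ` of the lattice Yang–Mills kernel `ymSpecification ρ β Λ η`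
(product Haar measure on the edges of `Λ`, boundary condition `η` glued outside) we prove the
finite-volume chord inequality of the convex function `β ↦ log N(β)`:
`log N(β') ≥ log N(β) - (β' - β) ⟨S_Λ⟩_{γ^{β,η}_Λ}`.
Proof: by the kernel integral formula `N(β') / N(β) = ∫ exp (-(β' - β) S_Λ) dγ^{β,η}_Λ`, and
Jensen's inequality for `exp` on the probability measure `γ^{β,η}_Λ` gives
`exp (-(β' - β) ∫ S_Λ dγ^{β,η}_Λ) ≤ N(β') / N(β)`; take logarithms
(Friedli–Velenik 2017, proof of Lemma 6.89 / Prop. 6.91 pattern; Lebowitz 1977 §3).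
-/

noncomputable section
open MeasureTheory Filter Topology Finset
open Literature.Probability.LatticeModels (Site halfOpenBox glueWith)
open Literature.MathematicalPhysics.QuantumLattice (LGConfig ZdEdge ZdPlaquette plaquetteObs plaquetteEdges
  plaquettesTouching wilsonBoundaryAction ymSpecification ymGibbsMeasures IsZdTranslationInvariant
  freeEnergyDensity configShift)
open Literature.MathematicalPhysics.QuantumFieldTheory (haarProbability zdHaar)

namespace Summit.QuantumFields.YangMills.Theorems.FibreToTorus

/-- **Jensen chord inequality for the kernel log-normaliser.** With
`N(β) = ∫ exp (-β S_Λ(ζ ∨ η)) dζ` the normaliser of `ymSpecification ρ β Λ η`,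
`log N(β) - (β' - β) ∫ S_Λ dγ^{β,η}_Λ ≤ log N(β')` (convexity of the finite-volume pressure in
`β`, chord below the graph; Friedli–Velenik 2017, Lemma 6.89). [folklore] -/
theorem energy_logNormaliser_chord : ∀ (d N : ℕ) (G : Type) [Group G] [TopologicalSpace G] [IsTopologicalGroup G] [CompactSpace G] [MeasurableSpace G] [BorelSpace G] [SecondCountableTopology G] (ρ : G →* Matrix (Fin N) (Fin N) ℂ), Continuous ρ → ∀ (Λ : Finset (ZdEdge d)) (η : LGConfig d G) (β β' : ℝ), Real.log (∫ ζ, Real.exp (-β * wilsonBoundaryAction ρ Λ (glueWith Λ ζ η)) ∂(MeasureTheory.Measure.pi fun _ : ↥Λ => haarProbability G)) - (β' - β) * ∫ U, wilsonBoundaryAction ρ Λ U ∂(ymSpecification ρ β Λ η) ≤ Real.log (∫ ζ, Real.exp (-β' * wilsonBoundaryAction ρ Λ (glueWith Λ ζ η)) ∂(MeasureTheory.Measure.pi fun _ : ↥Λ => haarProbability G)) := by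
  intro d N G _ _ _ _ _ _ _ ρ hρ Λ η β β'
  -- positivity of the two normalisers and the probability kernel `γ := γ^{β,η}_Λ`
  have hNβ := Literature.MathematicalPhysics.QuantumLattice.normaliser_pos ρ hρ β Λ η
  have hNβ' := Literature.MathematicalPhysics.QuantumLattice.normaliser_pos ρ hρ β' Λ η
  haveI := Literature.MathematicalPhysics.QuantumLattice.isProbabilityMeasure_ymSpecification
    ρ hρ β Λ η
  -- the action and the tilted observable `exp (-(β' - β) S_Λ)` are continuous, hence bounded
  have hS : Continuous (wilsonBoundaryAction (G := G) ρ Λ) :=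
    Literature.MathematicalPhysics.QuantumLattice.continuous_wilsonBoundaryAction ρ hρ Λ
  have hf : Continuous fun U : LGConfig d G => -(β' - β) * wilsonBoundaryAction ρ Λ U :=
    continuous_const.mul hS
  have hef : Continuous fun U : LGConfig d G =>
      Real.exp (-(β' - β) * wilsonBoundaryAction ρ Λ U) :=
    Real.continuous_exp.comp hf
  obtain ⟨Cf, hCf⟩ := Literature.MathematicalPhysics.QuantumLattice.exists_bound_of_continuous hf
  obtain ⟨Ce, hCe⟩ := Literature.MathematicalPhysics.QuantumLattice.exists_bound_of_continuous hef
  have hfi : Integrable (fun U : LGConfig d G => -(β' - β) * wilsonBoundaryAction ρ Λ U)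
      (ymSpecification ρ β Λ η) :=
    Literature.MathematicalPhysics.QuantumLattice.integrable_of_bound hf.aestronglyMeasurable hCf
  have hefi : Integrable (Real.exp ∘ fun U : LGConfig d G => -(β' - β) * wilsonBoundaryAction ρ Λ U)
      (ymSpecification ρ β Λ η) :=
    Literature.MathematicalPhysics.QuantumLattice.integrable_of_bound hef.aestronglyMeasurable hCe
  -- kernel integral formula: `γ(exp (-(β' - β) S_Λ)) = N(β') / N(β)`
  have hkey : ∫ U, Real.exp (-(β' - β) * wilsonBoundaryAction ρ Λ U) ∂(ymSpecification ρ β Λ η) =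
      (∫ ζ, Real.exp (-β' * wilsonBoundaryAction ρ Λ (glueWith Λ ζ η))
          ∂(Measure.pi fun _ : ↥Λ => haarProbability G)) /
        ∫ ζ, Real.exp (-β * wilsonBoundaryAction ρ Λ (glueWith Λ ζ η))
          ∂(Measure.pi fun _ : ↥Λ => haarProbability G) := by
    rw [Literature.MathematicalPhysics.QuantumLattice.integral_ymSpecification ρ hρ β Λ
      hef.measurable η]
    congr 1
    refine congrArg (fun g : (↥Λ → G) → ℝ => ∫ ζ, g ζ ∂(Measure.pi fun _ : ↥Λ => haarProbability G))
      (funext fun ζ => ?_)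
    rw [← Real.exp_add]
    congr 1
    ring
  -- Jensen for the convex `exp` on the probability measure `γ`
  have hJ : Real.exp (∫ U, -(β' - β) * wilsonBoundaryAction ρ Λ U ∂(ymSpecification ρ β Λ η)) ≤
      ∫ U, Real.exp (-(β' - β) * wilsonBoundaryAction ρ Λ U) ∂(ymSpecification ρ β Λ η) :=
    convexOn_exp.map_integral_le Real.continuous_exp.continuousOn isClosed_univ
      (ae_of_all _ fun _ => Set.mem_univ _) hfi hefi
  rw [integral_const_mul, hkey] at hJ
  -- take logarithms
  have hlog := (Real.le_log_iff_exp_le (div_pos hNβ' hNβ)).2 hJ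
  rw [Real.log_div hNβ'.ne' hNβ.ne'] at hlog
  linarith

end Summit.QuantumFields.YangMills.Theorems.FibreToTorus

end
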